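import Literature.Geometry.Kaehler.CechDeRham
import Literature.Geometry.Kaehler.LocalPQForms
import Literature.Algebra.Homology.DoubleComplexNaturality
import HarnessLib

/-!
# The Čech–Dolbeault double complex: Dolbeault cohomology from a `∂̄`-acyclic cover (Leray)

For an open cover `𝔘 = (U_i)_{i ∈ ι}` of a complex manifold `M` and a fixed `p`, the
**Čech–Dolbeault double complex** `K^{a,b} = C^a(𝔘, A^{p,b}) = Π_{(i₀,…,i_a)} A^{p,b}(U_{i₀…i_a})`
has the Čech differential `δ` horizontally and `(-1)^a ∂̄` vertically. Its rows, augmented by the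
restriction `r : A^{p,b}(M) → C⁰(𝔘, A^{p,b})`, are EXACT (generalized Mayer–Vietoris: the
contracting homotopy `(K ω)_{i₀…i_{a-1}} = Σ_i ρ_i ω_{i i₀ … i_{a-1}}` of a partition of unity
subordinate to `𝔘`; real cut-offs preserve the type `(p,q)`), and when all finite intersections
`U_J` have `H^{p,q}_{∂̄}(U_J) = 0` for `q ≥ 1` (a `∂̄`-acyclic = Leray cover for `Ω^p`), the
columns, augmented by the holomorphic `p`-forms `C^a(𝔘, Ω^p)`, are exact too, whence
**`H^{p,q}_{∂̄}(M) ≅ Ȟ^q(𝔘; Ω^p)`** — the Dolbeault theorem in Čech form / Leray's theorem for the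
acyclic cover (P. Griffiths, J. Harris, *Principles of Algebraic Geometry* (1978), pp. 40–45,
"the generalized de Rham argument … the Dolbeault theorem `H^q(M, Ω^p) ≅ H^{p,q}_{∂̄}(M)`" with the
Leray theorem p. 40; C. Voisin, *Hodge Theory and Complex Algebraic Geometry I* (2002), §4.3,
Thm. 4.41 / Cor. 4.38; the row-exactness argument is R. Bott, L. W. Tu (1982), Prop. 8.5 verbatim).

This file carries the argument out for the concrete Dolbeault complexes of open subsets of
`Literature/Geometry/Kaehler/LocalPQForms.lean` (`pqFormsOn`, `pqRestrict`, `localDbar`,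
`IsDolbeaultAcyclic`) and the FULL ordered Čech complex (all tuples `J : Fin (a + 1) → ι`), exactly
parallel to the Čech–de Rham file `CechDeRham.lean`, through the abstract double-complex theorems
`ADoubleComplex.rowColEquiv` (`DoubleComplexExactRows`) and its naturality
`ADoubleComplex.rowColEquiv_natural` (`DoubleComplexNaturality`):

* `CechPQForms U p a b = Π_J A^{p,b}(U_J)`, `cechδPQ`, `cechDbar = (-1)^a ∂̄`, the anticommuting
  double complex `cechDolbeault`; the row augmentation `cechDolbeaultRow` (restriction from `univ`)
  with `cechDolbeault_rowExact` / `cechDolbeaultRow_exact` from a smooth partition of unity;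
* `holFormsOn hW p = ker (∂̄_W : A^{p,0}(W) → A^{p,1}(W))` (holomorphic `p`-forms on `W`), the
  Čech complex `cechHolδ` of `Ω^p`, the column augmentation `cechDolbeaultCol`,
  `cechDolbeaultCol_exact` (tautological) and `cechDolbeault_colExact` from the acyclicity
  hypothesis `∀ a J, IsDolbeaultAcyclic E M (isOpen_cechSet hU J) p`;
* **`cechDolbeaultEquiv`** — `H^q(A^{p,•}(M), ∂̄) ≃ₗ[ℂ] H^q(C^•(𝔘, Ω^p), δ)` for a finite
  `∂̄`-acyclic cover of a Hausdorff σ-compact complex manifold;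
* **naturality under shrinking** (`cechDolbeaultEquiv_natural`): for a second cover `𝔘'` with
  `U'_i ⊆ U_i` (same index set), the two isomorphisms are intertwined by the restriction of
  holomorphic cochains `C^•(𝔘, Ω^p) → C^•(𝔘', Ω^p)` — in particular that restriction induces an
  ISOMORPHISM `H^q(𝔘, Ω^p) ≅ H^q(𝔘', Ω^p)` (Grauert–Remmert (1977), Kap. VI, Einleitung: "die
  untenstehenden Abbildungen bijektiv"), the Leray input of the Cartan–Serre finiteness theorem;
* `nonempty_cohomology_equiv_dolbeaultCohomology` — the global complex computes the tree's
  `dolbeaultCohomology E M p q`.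

No named facts; everything is proved.

## References

* P. Griffiths, J. Harris, *Principles of Algebraic Geometry* (1978), pp. 34–45 (Čech cohomology,
  Leray theorem, Dolbeault theorem). [GriffithsHarris1978]
* C. Voisin, *Hodge Theory and Complex Algebraic Geometry I* (2002), §4.3 (Thm. 4.41, Cor. 4.38).
  [VoisinHodgeI2002]
* R. Bott, L. W. Tu, *Differential Forms in Algebraic Topology* (1982), §8 (Prop. 8.5, Prop. 8.8,
  Thm. 8.9). [BottTu1982Forms]
* H. Grauert, R. Remmert, *Theorie der Steinschen Räume* (1977), Kap. VI, Einleitung.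
  [GrauertRemmert1977]
-/

noncomputable section

open scoped Manifold ContDiff Topology
open Set Filter Literature.Algebra.Homology Literature.NumberTheory.Transcendental

namespace Literature.Geometry.Kaehler

variable {E : Type*} [NormedAddCommGroup E] [NormedSpace ℂ E]
  {M : Type*} [TopologicalSpace M] [ChartedSpace E M]
  {ι : Type*}

/-! ### The Čech cochains with values in `(p,q)`-forms -/

omit [TopologicalSpace M] in
/-- Shrinking the cover shrinks the finite intersections. [folklore] -/
theorem cechSet_mono {U U' : ι → Set M} (h : ∀ i, U' i ⊆ U i) {n : ℕ} (J : Fin n → ι) :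
    cechSet U' J ⊆ cechSet U J :=
  fun _ hx ↦ mem_cechSet_iff.2 fun k ↦ h _ (mem_cechSet_iff.1 hx k)

variable (E M) in
/-- **The Čech `a`-cochains with values in `(p,b)`-forms**, `C^a(𝔘, A^{p,b}) = Π_J A^{p,b}(U_J)`
over all ordered `(a+1)`-tuples (Griffiths–Harris (1978), p. 44, `C^p(𝔘, A^{r,s})`; Bott–Tu's
`K^{p,q}` with forms of type `(p,q)` in place of `q`-forms). [cite: GriffithsHarris1978, p. 44] -/
abbrev CechPQForms (U : ι → Set M) (p a b : ℕ) : Type _ :=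
  ∀ J : Fin (a + 1) → ι, ↥(pqFormsOn E M (cechSet U J) p b)

section Cech

variable {U : ι → Set M} (hU : ∀ i, IsOpen (U i)) (p : ℕ)

variable (E M) in
/-- **The Čech differential** `(δ ω)_J = Σ_j (-1)^j ω_{J ∘ σ_j}|_{U_J}` on `C^a(𝔘, A^{p,b})`
(Bott–Tu (1982), (8.4); Griffiths–Harris (1978), p. 35). [cite: BottTu1982Forms, §8 (8.4)] -/
def cechδPQ (a b : ℕ) : CechPQForms E M U p a b →ₗ[ℂ] CechPQForms E M U p (a + 1) b where
  toFun c J := ∑ j : Fin (a + 2), (-1 : ℂ) ^ (j : ℕ) •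
    pqRestrict E M (isOpen_cechSet hU J) (cechSet_subset_comp U J (Fin.succAbove j)) p b
      (c (J ∘ Fin.succAbove j))
  map_add' c c' := by
    funext J
    simp only [Pi.add_apply, map_add, smul_add, Finset.sum_add_distrib]
  map_smul' r c := by
    funext J
    simp only [Pi.smul_apply, map_smul, RingHom.id_apply, Finset.smul_sum, smul_smul, mul_comm r]

/-- The Čech differential, componentwise. [cite: BottTu1982Forms, §8 (8.4)] -/
theorem cechδPQ_apply {a b : ℕ} (c : CechPQForms E M U p a b) (J : Fin (a + 2) → ι) :
    cechδPQ E M hU p a b c J = ∑ j : Fin (a + 2), (-1 : ℂ) ^ (j : ℕ) •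
      pqRestrict E M (isOpen_cechSet hU J) (cechSet_subset_comp U J (Fin.succAbove j)) p b
        (c (J ∘ Fin.succAbove j)) :=
  rfl

/-- The Čech differential on underlying forms. [cite: BottTu1982Forms, §8 (8.4)] -/
theorem coe_cechδPQ_apply {a b : ℕ} (c : CechPQForms E M U p a b) (J : Fin (a + 2) → ι) :
    (cechδPQ E M hU p a b c J : MForm 𝓘(ℝ, E) M ℂ (p + b)) = ∑ j : Fin (a + 2), (-1 : ℂ) ^ (j : ℕ) •
      (c (J ∘ Fin.succAbove j) : MForm 𝓘(ℝ, E) M ℂ (p + b)).restr (cechSet U J) := by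
  rw [cechδPQ_apply, Submodule.coe_sum]
  simp only [Submodule.coe_smul, coe_pqRestrict]

/-- The Čech differential on underlying forms, at a point of `U_J`. [folklore] -/
theorem coe_cechδPQ_apply_apply_of_mem {a b : ℕ} (c : CechPQForms E M U p a b) {J : Fin (a + 2) → ι}
    {y : M} (hy : y ∈ cechSet U J) :
    (cechδPQ E M hU p a b c J : MForm 𝓘(ℝ, E) M ℂ (p + b)) y = ∑ j : Fin (a + 2), (-1 : ℂ) ^ (j : ℕ) •
      (c (J ∘ Fin.succAbove j) : MForm 𝓘(ℝ, E) M ℂ (p + b)) y := by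
  rw [coe_cechδPQ_apply, Finset.sum_apply]
  refine Finset.sum_congr rfl fun j _ ↦ ?_
  rw [Pi.smul_apply, MForm.restr_apply_of_mem _ hy]

variable [FiniteDimensional ℂ E] [T2Space M] [IsManifold 𝓘(ℂ, E) ω M] [IsManifold 𝓘(ℝ, E) ∞ M]

variable (E M) in
/-- **The vertical differential** `(-1)^a ∂̄` on `C^a(𝔘, A^{p,•})` (Weibel's sign trick 1.2.5).
[cite: Weibel1994, 1.2.5] -/
def cechDbar (a b : ℕ) : CechPQForms E M U p a b →ₗ[ℂ] CechPQForms E M U p a (b + 1) where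
  toFun c J := (-1 : ℂ) ^ a • localDbar E M (isOpen_cechSet hU J) p b (c J)
  map_add' c c' := by
    funext J
    simp only [Pi.add_apply, map_add, smul_add]
  map_smul' r c := by
    funext J
    simp only [Pi.smul_apply, map_smul, RingHom.id_apply, smul_comm r]

/-- The vertical differential, componentwise. [cite: Weibel1994, 1.2.5] -/
theorem cechDbar_apply {a b : ℕ} (c : CechPQForms E M U p a b) (J : Fin (a + 1) → ι) :
    cechDbar E M hU p a b c J = (-1 : ℂ) ^ a • localDbar E M (isOpen_cechSet hU J) p b (c J) :=
  rfl

/-- `∂̄` commutes with the restriction along a face (`localDbar_pqRestrict` with all arguments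
determined by the left-hand side). [folklore] -/
theorem localDbar_pqRestrict_face {a b : ℕ} (J : Fin (a + 2) → ι) (j : Fin (a + 2))
    (α : ↥(pqFormsOn E M (cechSet U (J ∘ Fin.succAbove j)) p b)) :
    localDbar E M (isOpen_cechSet hU J) p b
        (pqRestrict E M (isOpen_cechSet hU J) (cechSet_subset_comp U J (Fin.succAbove j)) p b α) =
      pqRestrict E M (isOpen_cechSet hU J) (cechSet_subset_comp U J (Fin.succAbove j)) p (b + 1)
        (localDbar E M (isOpen_cechSet hU (J ∘ Fin.succAbove j)) p b α) :=
  localDbar_pqRestrict _ _ _ α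

variable (E M) in
/-- **The Čech–Dolbeault double complex** `C^a(𝔘, A^{p,b})` of an open cover of a complex
manifold, as an anticommuting double complex (`δ ∘ δ = 0` by the tuple combinatorics of
`CechTupleFaces`, `∂̄ ∘ ∂̄ = 0` by `localDbar_localDbar`, anticommutation by naturality of `∂̄`
and the sign `(-1)^a`). Griffiths–Harris (1978), p. 44. [cite: GriffithsHarris1978, p. 44] -/
def cechDolbeault : ADoubleComplex ℂ (CechPQForms E M U p) where
  d a b := cechDbar E M hU p a b
  δ a b := cechδPQ E M hU p a b
  d_d a b c := by
    funext J
    rw [cechDbar_apply, cechDbar_apply, map_smul, localDbar_localDbar, smul_zero, smul_zero]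
    rfl
  δ_δ a b c := by
    funext J
    apply Subtype.ext
    rw [coe_cechδPQ_apply, Pi.zero_apply, ZeroMemClass.coe_zero]
    simp_rw [coe_cechδPQ_apply, MForm.restr_sum, MForm.restr_smul_complex, restr_restr_cechSet_comp,
      Finset.smul_sum]
    exact CechTuple.sum_sum_neg_one_pow_smul_smul_faces_eq_zero (R := ℂ)
      (fun θ ↦ ((c (J ∘ θ) : MForm 𝓘(ℝ, E) M ℂ (p + b))).restr (cechSet U J))
  anticomm a b c := by
    funext J
    rw [Pi.add_apply, Pi.zero_apply, cechδPQ_apply, cechDbar_apply, cechδPQ_apply, map_sum, Finset.smul_sum,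
      ← Finset.sum_add_distrib]
    refine Finset.sum_eq_zero fun j _ ↦ ?_
    rw [cechDbar_apply, map_smul, map_smul, localDbar_pqRestrict_face hU p, smul_smul, smul_smul,
      ← add_smul,
      show (-1 : ℂ) ^ (j : ℕ) * (-1) ^ a + (-1) ^ (a + 1) * (-1) ^ (j : ℕ) = 0 by ring, zero_smul]

/-! ### The row augmentation: restriction from `M` -/

variable (E M) in
/-- **The row augmentation** of the Čech–Dolbeault complex by the Dolbeault complex of `M`: the
restriction `r : A^{p,b}(M) → C⁰(𝔘, A^{p,b})`, `(r ω)_{(i)} = ω|_{U_i}` (`δ ∘ r = 0`; Bott–Tu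
(1982), (8.5)–(8.6); Griffiths–Harris (1978), p. 44). [cite: BottTu1982Forms, §8 Prop. 8.5] -/
def cechDolbeaultRow :
    (cechDolbeault E M hU p).RowAugmentation (fun b ↦ ↥(pqFormsOn E M (univ : Set M) p b)) where
  dA b := localDbar E M isOpen_univ p b
  ε b :=
    { toFun := fun α J ↦ pqRestrict E M (isOpen_cechSet hU J) (subset_univ _) p b α
      map_add' := fun α β ↦ by funext J; simp only [map_add, Pi.add_apply]
      map_smul' := fun c α ↦ by funext J; simp only [map_smul, Pi.smul_apply, RingHom.id_apply] }
  ε_dA b α := by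
    funext J
    change pqRestrict E M (isOpen_cechSet hU J) (subset_univ _) p (b + 1) (localDbar E M isOpen_univ p b α) =
      cechDbar E M hU p 0 b (fun J ↦ pqRestrict E M (isOpen_cechSet hU J) (subset_univ _) p b α) J
    rw [cechDbar_apply, pow_zero, one_smul, localDbar_pqRestrict]
  δ_ε b α := by
    funext J
    change cechδPQ E M hU p 0 b (fun J ↦ pqRestrict E M (isOpen_cechSet hU J) (subset_univ _) p b α) J = 0
    apply Subtype.ext
    rw [coe_cechδPQ_apply, Fin.sum_univ_two, ZeroMemClass.coe_zero]
    simp only [Fin.val_zero, pow_zero, one_smul, Fin.val_one, pow_one, neg_smul, coe_pqRestrict,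
      restr_restr_cechSet_comp, add_neg_cancel]

/-- The row augmentation on underlying forms. [folklore] -/
theorem coe_cechDolbeaultRow_ε {b : ℕ} (α : ↥(pqFormsOn E M (univ : Set M) p b)) (J : Fin 1 → ι) :
    ((cechDolbeaultRow E M hU p).ε b α J : MForm 𝓘(ℝ, E) M ℂ (p + b)) =
      (α : MForm 𝓘(ℝ, E) M ℂ (p + b)).restr (cechSet U J) :=
  rfl

/-! ### Exactness of the rows (partition of unity) -/

section Rows

variable [Fintype ι] (ρ : SmoothPartitionOfUnity ι 𝓘(ℝ, E) M univ) (hρ : ρ.IsSubordinate U)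

omit [FiniteDimensional ℂ E] [T2Space M] [IsManifold 𝓘(ℂ, E) ω M] [IsManifold 𝓘(ℝ, E) ∞ M]
  [Fintype ι] in
include hρ in
/-- The terms `ρ_i • ω_{(i, J)}` of the contracting homotopy are `(p,b)`-forms on `U_J` (real
cut-offs preserve the type). [cite: BottTu1982Forms, Prop. 8.5] -/
theorem smul_cons_mem_pqFormsOn {a b : ℕ} (c : CechPQForms E M U p (a + 1) b) (J : Fin (a + 1) → ι)
    (i : ι) :
    (ρ i : M → ℝ) • (c (Fin.cons i J : Fin (a + 2) → ι) : MForm 𝓘(ℝ, E) M ℂ (p + b)) ∈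
      pqFormsOn E M (cechSet U J) p b := by
  have h := fun_smul_mem_smoothFormsOn_of_tsupport_subset (ρ i).contMDiff (hρ i)
    (W := cechSet U J) (α := (c (Fin.cons i J : Fin (a + 2) → ι) : MForm 𝓘(ℝ, E) M ℂ (p + b)))
    (by rw [← cechSet_cons]; exact mem_smoothFormsOn_of_mem_pqFormsOn (c _).2)
  exact ⟨h.1, h.2, (c _).2.2.2.fun_smul _⟩

omit [FiniteDimensional ℂ E] [T2Space M] [IsManifold 𝓘(ℂ, E) ω M] [IsManifold 𝓘(ℝ, E) ∞ M] in
include hρ in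
/-- The contracting homotopy `(K ω)_J = Σ_i ρ_i ω_{(i, J)}` lands in `A^{p,b}(U_J)`.
[cite: BottTu1982Forms, Prop. 8.5] -/
theorem sum_smul_cons_mem_pqFormsOn {a b : ℕ} (c : CechPQForms E M U p (a + 1) b)
    (J : Fin (a + 1) → ι) :
    ∑ i, (ρ i : M → ℝ) • (c (Fin.cons i J : Fin (a + 2) → ι) : MForm 𝓘(ℝ, E) M ℂ (p + b)) ∈
      pqFormsOn E M (cechSet U J) p b :=
  Submodule.sum_mem _ fun i _ ↦ smul_cons_mem_pqFormsOn p ρ hρ c J i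

omit [FiniteDimensional ℂ E] [T2Space M] [IsManifold 𝓘(ℂ, E) ω M] [IsManifold 𝓘(ℝ, E) ∞ M]
  [Fintype ι] in
/-- **The cocycle identity behind the contraction**: if `δ ω = 0` then on `U_i ∩ U_J`,
`ω_J = Σ_j (-1)^j ω_{(i, J ∘ σ_j)}`. [cite: BottTu1982Forms, Prop. 8.5] -/
theorem apply_eq_sum_of_cechδPQ_eq_zero {a b : ℕ} {c : CechPQForms E M U p (a + 1) b}
    (hc : cechδPQ E M hU p (a + 1) b c = 0) (J : Fin (a + 2) → ι) (i : ι) {y : M} (hyi : y ∈ U i)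
    (hy : y ∈ cechSet U J) :
    (c J : MForm 𝓘(ℝ, E) M ℂ (p + b)) y = ∑ j : Fin (a + 2), (-1 : ℂ) ^ (j : ℕ) •
      (c (Fin.cons i (J ∘ Fin.succAbove j) : Fin (a + 2) → ι) : MForm 𝓘(ℝ, E) M ℂ (p + b)) y := by
  have hyc : y ∈ cechSet U (Fin.cons i J : Fin (a + 3) → ι) := by
    rw [cechSet_cons]
    exact ⟨hyi, hy⟩
  have h0 : (cechδPQ E M hU p (a + 1) b c (Fin.cons i J : Fin (a + 3) → ι) : MForm 𝓘(ℝ, E) M ℂ (p + b)) y = 0 := by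
    rw [hc]
    rfl
  rw [coe_cechδPQ_apply_apply_of_mem hU p c hyc,
    CechTuple.sum_neg_one_pow_smul_cons_faces (R := ℂ) i J
      (fun S ↦ (c S : MForm 𝓘(ℝ, E) M ℂ (p + b)) y), sub_eq_zero] at h0
  exact h0

omit [FiniteDimensional ℂ E] [T2Space M] [IsManifold 𝓘(ℂ, E) ω M] [IsManifold 𝓘(ℝ, E) ∞ M]
  [Fintype ι] in
/-- **The cocycle identity in the column `0`**: if `δ ω = 0` for a `0`-cochain then
`ω_{(i)} = ω_J` on `U_i ∩ U_J` for every `1`-tuple `J`. [cite: BottTu1982Forms, Prop. 8.5] -/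
theorem apply_eq_apply_of_cechδPQ_eq_zero {b : ℕ} {c : CechPQForms E M U p 0 b}
    (hc : cechδPQ E M hU p 0 b c = 0) (J : Fin 1 → ι) (i : ι) {y : M} (hyi : y ∈ U i)
    (hy : y ∈ cechSet U J) :
    (c (fun _ ↦ i) : MForm 𝓘(ℝ, E) M ℂ (p + b)) y = (c J : MForm 𝓘(ℝ, E) M ℂ (p + b)) y := by
  have hyc : y ∈ cechSet U (Fin.cons i J : Fin 2 → ι) := by
    rw [cechSet_cons]
    exact ⟨hyi, hy⟩
  have h0 : (cechδPQ E M hU p 0 b c (Fin.cons i J : Fin 2 → ι) : MForm 𝓘(ℝ, E) M ℂ (p + b)) y = 0 := by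
    rw [hc]
    rfl
  rw [coe_cechδPQ_apply_apply_of_mem hU p c hyc, Fin.sum_univ_two, Fin.val_zero, pow_zero, one_smul,
    Fin.val_one, pow_one, neg_one_smul, add_neg_eq_zero] at h0
  have e0 : ((Fin.cons i J : Fin 2 → ι) ∘ Fin.succAbove (0 : Fin 2)) = J :=
    CechTuple.cons_comp_succAbove_zero i J
  have e1 : ((Fin.cons i J : Fin 2 → ι) ∘ Fin.succAbove (1 : Fin 2)) = fun _ ↦ i := by
    funext k
    rw [Subsingleton.elim k 0]
    rfl
  have f0 := congrArg (fun S : Fin 1 → ι ↦ (c S : MForm 𝓘(ℝ, E) M ℂ (p + b)) y) e0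
  have f1 := congrArg (fun S : Fin 1 → ι ↦ (c S : MForm 𝓘(ℝ, E) M ℂ (p + b)) y) e1
  exact (f0.symm.trans (h0.trans f1)).symm

include hρ in
/-- **Exactness of the Čech rows in positive columns** (Bott–Tu (1982), Prop. 8.5 for
`(p,b)`-forms: if `δ ω = 0` then `ω = δ (K ω)`). [cite: BottTu1982Forms, Prop. 8.5] -/
theorem cechDolbeault_rowExact : (cechDolbeault E M hU p).RowExact := by
  refine ⟨fun a b c hc ↦ ?_⟩
  refine ⟨fun J ↦ ⟨∑ i, (ρ i : M → ℝ) • (c (Fin.cons i J : Fin (a + 2) → ι) : MForm 𝓘(ℝ, E) M ℂ (p + b)),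
    sum_smul_cons_mem_pqFormsOn p ρ hρ c J⟩, ?_⟩
  funext T
  apply Subtype.ext
  change (cechδPQ E M hU p a b _ T : MForm 𝓘(ℝ, E) M ℂ (p + b)) = (c T : MForm 𝓘(ℝ, E) M ℂ (p + b))
  funext y
  by_cases hy : y ∈ cechSet U T
  · rw [coe_cechδPQ_apply_apply_of_mem hU p _ hy]
    calc ∑ j : Fin (a + 2), (-1 : ℂ) ^ (j : ℕ) •
          (∑ i, (ρ i : M → ℝ) • (c (Fin.cons i (T ∘ Fin.succAbove j) : Fin (a + 2) → ι) :
            MForm 𝓘(ℝ, E) M ℂ (p + b))) y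
        = ∑ i, ρ i y • ∑ j : Fin (a + 2), (-1 : ℂ) ^ (j : ℕ) •
            (c (Fin.cons i (T ∘ Fin.succAbove j) : Fin (a + 2) → ι) : MForm 𝓘(ℝ, E) M ℂ (p + b)) y := by
          simp only [Finset.sum_apply, Pi.smul_apply', Finset.smul_sum]
          rw [Finset.sum_comm]
          exact Finset.sum_congr rfl fun i _ ↦ Finset.sum_congr rfl fun j _ ↦ smul_comm _ _ _
      _ = ∑ i, ρ i y • (c T : MForm 𝓘(ℝ, E) M ℂ (p + b)) y := by
          refine Finset.sum_congr rfl fun i _ ↦ ?_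
          by_cases hyi : y ∈ U i
          · rw [apply_eq_sum_of_cechδPQ_eq_zero hU p hc T i hyi hy]
          · rw [rho_apply_eq_zero ρ hρ hyi, zero_smul, zero_smul]
      _ = (c T : MForm 𝓘(ℝ, E) M ℂ (p + b)) y := by
          rw [← Finset.sum_smul, sum_rho_apply, one_smul]
  · rw [(c T).2.2.1 y hy]
    exact (cechδPQ E M hU p a b _ T).2.2.1 y hy

include hρ in
/-- **Exactness of the augmented rows at the column `0`** (`r` is injective because `𝔘` covers
`M`; a `δ`-cocycle `(ω_i)` glues to the global form `Σ_i ρ_i ω_i`, of the same type).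
[cite: BottTu1982Forms, Prop. 8.5] -/
theorem cechDolbeaultRow_exact (hcov : ∀ y : M, ∃ i, y ∈ U i) : (cechDolbeaultRow E M hU p).Exact := by
  constructor
  · -- injectivity of `r`
    intro b α β h
    apply Subtype.ext
    funext y
    obtain ⟨i, hyi⟩ := hcov y
    have hyU : y ∈ cechSet U (fun _ : Fin 1 ↦ i) := by
      rw [cechSet_fin_one]
      exact hyi
    have h' := congrArg (fun c : CechPQForms E M U p 0 b ↦ (c (fun _ ↦ i) : MForm 𝓘(ℝ, E) M ℂ (p + b)) y) h
    simp only [coe_cechDolbeaultRow_ε] at h'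
    rwa [MForm.restr_apply_of_mem _ hyU, MForm.restr_apply_of_mem _ hyU] at h'
  · -- `ker δ₀ ⊆ im r`
    intro b c hc
    have hmem : ∑ i, (ρ i : M → ℝ) • (c (fun _ : Fin 1 ↦ i) : MForm 𝓘(ℝ, E) M ℂ (p + b)) ∈
        pqFormsOn E M (univ : Set M) p b := by
      refine Submodule.sum_mem _ fun i _ ↦ ?_
      have h := fun_smul_mem_smoothFormsOn_of_tsupport_subset (ρ i).contMDiff (hρ i)
        (W := (univ : Set M)) (α := (c (fun _ : Fin 1 ↦ i) : MForm 𝓘(ℝ, E) M ℂ (p + b)))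
        (by rw [inter_univ, ← cechSet_fin_one U (fun _ ↦ i)]
            exact mem_smoothFormsOn_of_mem_pqFormsOn (c _).2)
      exact ⟨h.1, h.2, (c _).2.2.2.fun_smul _⟩
    refine ⟨⟨_, hmem⟩, ?_⟩
    funext J
    apply Subtype.ext
    rw [coe_cechDolbeaultRow_ε]
    funext y
    by_cases hy : y ∈ cechSet U J
    · have hcoc : ∀ i, y ∈ U i →
          (c (fun _ : Fin 1 ↦ i) : MForm 𝓘(ℝ, E) M ℂ (p + b)) y = (c J : MForm 𝓘(ℝ, E) M ℂ (p + b)) y :=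
        fun i hyi ↦ apply_eq_apply_of_cechδPQ_eq_zero hU p hc J i hyi hy
      rw [MForm.restr_apply_of_mem _ hy]
      simp only [Finset.sum_apply, Pi.smul_apply']
      calc ∑ i, ρ i y • (c (fun _ : Fin 1 ↦ i) : MForm 𝓘(ℝ, E) M ℂ (p + b)) y
          = ∑ i, ρ i y • (c J : MForm 𝓘(ℝ, E) M ℂ (p + b)) y := by
            refine Finset.sum_congr rfl fun i _ ↦ ?_
            by_cases hyi : y ∈ U i
            · rw [hcoc i hyi]
            · rw [rho_apply_eq_zero ρ hρ hyi, zero_smul, zero_smul]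
        _ = (c J : MForm 𝓘(ℝ, E) M ℂ (p + b)) y := by rw [← Finset.sum_smul, sum_rho_apply, one_smul]
    · rw [MForm.restr_apply_of_notMem _ hy, (c J).2.2.1 y hy]

end Rows

/-! ### The column augmentation: holomorphic `p`-forms -/

variable (E M) in
/-- **The holomorphic `p`-forms on an open `W`**, `Ω^p(W) = ker (∂̄_W : A^{p,0}(W) → A^{p,1}(W))`
(Voisin (2002), §2.3.3 / Griffiths–Harris (1978), p. 25: a `(p,0)`-form is holomorphic iff it is
`∂̄`-closed). [cite: VoisinHodgeI2002, §2.3.3] -/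
def holFormsOn {W : Set M} (hW : IsOpen W) (p : ℕ) : Submodule ℂ ↥(pqFormsOn E M W p 0) :=
  LinearMap.ker (localDbar E M hW p 0)

/-- Membership in `holFormsOn`. [folklore] -/
theorem mem_holFormsOn_iff {W : Set M} (hW : IsOpen W) {α : ↥(pqFormsOn E M W p 0)} :
    α ∈ holFormsOn E M hW p ↔ localDbar E M hW p 0 α = 0 :=
  LinearMap.mem_ker

/-- Restriction to a smaller open set preserves holomorphy. [cite: VoisinHodgeI2002, §2.3.3] -/
theorem pqRestrict_mem_holFormsOn {W W' : Set M} (hW : IsOpen W) (hW' : IsOpen W') (h : W' ⊆ W)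
    {α : ↥(pqFormsOn E M W p 0)} (hα : α ∈ holFormsOn E M hW p) :
    pqRestrict E M hW' h p 0 α ∈ holFormsOn E M hW' p := by
  rw [mem_holFormsOn_iff] at hα ⊢
  rw [localDbar_pqRestrict hW hW' h, hα, map_zero]

variable (E M) in
/-- Restriction of holomorphic forms `Ω^p(W) → Ω^p(W')` for open `W' ⊆ W`. [folklore] -/
def holRestrict {W W' : Set M} (hW : IsOpen W) (hW' : IsOpen W') (h : W' ⊆ W) (p : ℕ) :
    ↥(holFormsOn E M hW p) →ₗ[ℂ] ↥(holFormsOn E M hW' p) :=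
  (pqRestrict E M hW' h p 0).restrict fun _ hα ↦ pqRestrict_mem_holFormsOn p hW hW' h hα

/-- Underlying form of a restricted holomorphic form. [folklore] -/
@[simp]
theorem coe_coe_holRestrict {W W' : Set M} (hW : IsOpen W) (hW' : IsOpen W') (h : W' ⊆ W)
    (α : ↥(holFormsOn E M hW p)) :
    ((holRestrict E M hW hW' h p α : ↥(pqFormsOn E M W' p 0)) : MForm 𝓘(ℝ, E) M ℂ (p + 0)) =
      ((α : ↥(pqFormsOn E M W p 0)) : MForm 𝓘(ℝ, E) M ℂ (p + 0)).restr W' :=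
  rfl

variable (E M) in
/-- **The Čech `a`-cochains with values in holomorphic `p`-forms**, `C^a(𝔘, Ω^p)`.
[cite: GriffithsHarris1978, p. 35] -/
abbrev CechHolForms (U : ι → Set M) (hU : ∀ i, IsOpen (U i)) (p a : ℕ) : Type _ :=
  ∀ J : Fin (a + 1) → ι, ↥(holFormsOn E M (isOpen_cechSet hU J) p)

variable (E M) in
/-- **The Čech differential on holomorphic `p`-forms** (formula (8.4); restriction preserves
holomorphy). [cite: BottTu1982Forms, §8 (8.4)] -/
def cechHolδ (a : ℕ) : CechHolForms E M U hU p a →ₗ[ℂ] CechHolForms E M U hU p (a + 1) where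
  toFun g J := ∑ j : Fin (a + 2), (-1 : ℂ) ^ (j : ℕ) •
    holRestrict E M (isOpen_cechSet hU (J ∘ Fin.succAbove j)) (isOpen_cechSet hU J)
      (cechSet_subset_comp U J (Fin.succAbove j)) p (g (J ∘ Fin.succAbove j))
  map_add' g g' := by
    funext J
    simp only [Pi.add_apply, map_add, smul_add, Finset.sum_add_distrib]
  map_smul' r g := by
    funext J
    simp only [Pi.smul_apply, map_smul, RingHom.id_apply, Finset.smul_sum, smul_smul, mul_comm r]

variable (E M) in
/-- The inclusion `Ω^p(U_J) ↪ A^{p,0}(U_J)` on Čech cochains. [folklore] -/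
def cechHolIncl (a : ℕ) : CechHolForms E M U hU p a →ₗ[ℂ] CechPQForms E M U p a 0 where
  toFun g J := (g J : ↥(pqFormsOn E M (cechSet U J) p 0))
  map_add' _ _ := rfl
  map_smul' _ _ := rfl

/-- The Čech differentials are intertwined by the inclusion. [folklore] -/
theorem cechHolIncl_cechHolδ {a : ℕ} (g : CechHolForms E M U hU p a) :
    cechHolIncl E M hU p (a + 1) (cechHolδ E M hU p a g) = cechδPQ E M hU p a 0 (cechHolIncl E M hU p a g) := by
  funext J
  change ((∑ j : Fin (a + 2), (-1 : ℂ) ^ (j : ℕ) •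
    holRestrict E M (isOpen_cechSet hU (J ∘ Fin.succAbove j)) (isOpen_cechSet hU J)
      (cechSet_subset_comp U J (Fin.succAbove j)) p (g (J ∘ Fin.succAbove j)) :
        ↥(holFormsOn E M (isOpen_cechSet hU J) p)) : ↥(pqFormsOn E M (cechSet U J) p 0)) = _
  rw [Submodule.coe_sum]
  rfl

variable (E M) in
/-- **The column augmentation** of the Čech–Dolbeault complex by the Čech complex of holomorphic
`p`-forms: `Ω^p(U_J) = ker (∂̄ : A^{p,0}(U_J) → A^{p,1}(U_J))` (Griffiths–Harris (1978), p. 45: the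
augmented columns `0 → C^a(𝔘, Ω^p) → C^a(𝔘, A^{p,0}) → C^a(𝔘, A^{p,1}) → ⋯`).
[cite: GriffithsHarris1978, p. 45] -/
def cechDolbeaultCol : (cechDolbeault E M hU p).ColAugmentation (CechHolForms E M U hU p) where
  dA a := cechHolδ E M hU p a
  ε a := cechHolIncl E M hU p a
  ε_dA a g := cechHolIncl_cechHolδ hU p g
  δ_ε a g := by
    funext J
    have h := (mem_holFormsOn_iff p (isOpen_cechSet hU J)).1 (g J).2
    change (-1 : ℂ) ^ a • localDbar E M (isOpen_cechSet hU J) p 0 (g J : ↥(pqFormsOn E M (cechSet U J) p 0)) = 0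
    rw [h, smul_zero]

/-- **Exactness of the augmented columns at the row `0`** (tautological: `Ω^p = ker ∂̄₀`).
[cite: GriffithsHarris1978, p. 45] -/
theorem cechDolbeaultCol_exact : (cechDolbeaultCol E M hU p).Exact := by
  constructor
  · intro a g g' h
    funext J
    apply Subtype.ext
    exact congrFun h J
  · intro a c hc
    have hcl : ∀ J, c J ∈ holFormsOn E M (isOpen_cechSet hU J) p := fun J ↦ by
      rw [mem_holFormsOn_iff]
      have h := congrFun hc J
      change cechDbar E M hU p a 0 c J = 0 at h
      rw [cechDbar_apply] at h
      exact (smul_eq_zero_iff_right (pow_ne_zero _ (by norm_num))).1 h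
    exact ⟨fun J ↦ ⟨c J, hcl J⟩, rfl⟩

/-- **Exactness of the columns in positive rows from `∂̄`-acyclicity of the finite
intersections** (Griffiths–Harris (1978), p. 45: the `∂̄`-Poincaré lemma on the `U_J`).
[cite: GriffithsHarris1978, p. 45] -/
theorem cechDolbeault_colExact
    (hacyc : ∀ (a : ℕ) (J : Fin (a + 1) → ι), IsDolbeaultAcyclic E M (isOpen_cechSet hU J) p) :
    (cechDolbeault E M hU p).ColExact := by
  refine ⟨fun a b c hc ↦ ?_⟩
  have hex : ∀ J, ∃ β : ↥(pqFormsOn E M (cechSet U J) p b),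
      localDbar E M (isOpen_cechSet hU J) p b β = c J := fun J ↦ by
    apply hacyc a J b (c J)
    have h := congrFun hc J
    change cechDbar E M hU p a (b + 1) c J = 0 at h
    rw [cechDbar_apply] at h
    exact (smul_eq_zero_iff_right (pow_ne_zero _ (by norm_num))).1 h
  choose β hβ using hex
  refine ⟨fun J ↦ (-1 : ℂ) ^ a • β J, ?_⟩
  funext J
  change cechDbar E M hU p a b (fun J ↦ (-1 : ℂ) ^ a • β J) J = c J
  rw [cechDbar_apply, map_smul, smul_smul, ← pow_add, ← two_mul, pow_mul, neg_one_sq, one_pow, one_smul]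
  exact hβ J

/-! ### The comparison `H^{p,•}_{∂̄}(M) ≅ H^•(𝔘, Ω^p)` -/

variable (E M) in
/-- **The Čech–Dolbeault isomorphism (Dolbeault's theorem in Čech form / Leray's theorem for a
`∂̄`-acyclic finite cover)**: for a finite open cover `𝔘 = (U_i)` of a Hausdorff σ-compact complex
manifold all of whose finite intersections `U_J` have `H^{p,q}_{∂̄}(U_J) = 0` for `q ≥ 1`, the
cohomology of the Dolbeault complex `(A^{p,•}(M), ∂̄)` is isomorphic in every degree to the
cohomology of the Čech complex `(C^•(𝔘, Ω^p), δ)` of holomorphic `p`-forms (both are the total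
cohomology of the Čech–Dolbeault double complex). Griffiths–Harris (1978), p. 45; Voisin (2002),
Thm. 4.41 with Cor. 4.38. [cite: GriffithsHarris1978, p. 45] -/
def cechDolbeaultEquiv [SigmaCompactSpace M] [Fintype ι] (hcov : ⋃ i, U i = univ)
    (hacyc : ∀ (a : ℕ) (J : Fin (a + 1) → ι), IsDolbeaultAcyclic E M (isOpen_cechSet hU J) p) (q : ℕ) :
    NatCochain.Cohomology (R := ℂ) (fun b ↦ localDbar E M (isOpen_univ : IsOpen (univ : Set M)) p b) q ≃ₗ[ℂ]
      NatCochain.Cohomology (R := ℂ) (A := CechHolForms E M U hU p) (cechHolδ E M hU p) q :=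
  have hρ := (SmoothPartitionOfUnity.exists_isSubordinate 𝓘(ℝ, E) isClosed_univ U hU
    hcov.symm.subset).choose_spec
  ADoubleComplex.rowColEquiv (cechDolbeaultRow E M hU p) (cechDolbeaultCol E M hU p)
    (cechDolbeault_rowExact hU p _ hρ)
    (cechDolbeaultRow_exact hU p _ hρ fun y ↦ mem_iUnion.1 (hcov.symm.subset (mem_univ y)))
    (cechDolbeault_colExact hU p hacyc) (cechDolbeaultCol_exact hU p) q

/-! ### Naturality under shrinking of the cover -/

section Shrink

variable {U' : ι → Set M} (hU' : ∀ i, IsOpen (U' i)) (hsub : ∀ i, U' i ⊆ U i)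

variable (E M) in
/-- **Restriction of the Čech–Dolbeault double complex to a shrunken cover** `U'_i ⊆ U_i`
(componentwise restriction `A^{p,b}(U_J) → A^{p,b}(U'_J)`), a morphism of double complexes
(Bott–Tu (1982), §8: restriction is a chain map of double complexes). [cite: BottTu1982Forms, §8] -/
def cechDolbeaultShrink : (cechDolbeault E M hU p).Hom (cechDolbeault E M hU' p) where
  f a b :=
    { toFun := fun c J ↦ pqRestrict E M (isOpen_cechSet hU' J) (cechSet_mono hsub J) p b (c J)
      map_add' := fun c c' ↦ by funext J; simp only [Pi.add_apply, map_add]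
      map_smul' := fun r c ↦ by funext J; simp only [Pi.smul_apply, map_smul, RingHom.id_apply] }
  f_d a b c := by
    funext J
    change pqRestrict E M (isOpen_cechSet hU' J) (cechSet_mono hsub J) p (b + 1) (cechDbar E M hU p a b c J) =
      cechDbar E M hU' p a b (fun J ↦ pqRestrict E M (isOpen_cechSet hU' J) (cechSet_mono hsub J) p b (c J)) J
    rw [cechDbar_apply, cechDbar_apply, map_smul, localDbar_pqRestrict]
  f_δ a b c := by
    funext J
    apply Subtype.ext
    change ((cechδPQ E M hU p a b c J : MForm 𝓘(ℝ, E) M ℂ (p + b))).restr (cechSet U' J) =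
      (cechδPQ E M hU' p a b (fun J ↦ pqRestrict E M (isOpen_cechSet hU' J) (cechSet_mono hsub J) p b (c J)) J :
        MForm 𝓘(ℝ, E) M ℂ (p + b))
    rw [coe_cechδPQ_apply, coe_cechδPQ_apply, MForm.restr_sum]
    refine Finset.sum_congr rfl fun j _ ↦ ?_
    rw [MForm.restr_smul_complex, coe_pqRestrict, MForm.restr_restr, MForm.restr_restr,
      inter_eq_left.2 (cechSet_mono hsub J),
      inter_eq_left.2 (cechSet_subset_comp U' J (Fin.succAbove j))]

variable (E M) in
/-- The identity of the global Dolbeault complex is a morphism of row augmentations over the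
shrinking morphism. [cite: BottTu1982Forms, §8] -/
def cechDolbeaultRowShrink :
    ADoubleComplex.RowAugmentation.Hom (cechDolbeaultRow E M hU p) (cechDolbeaultRow E M hU' p)
      (cechDolbeaultShrink E M hU p hU' hsub) where
  g b := LinearMap.id
  g_dA _ _ := rfl
  ε_g b α := by
    funext J
    apply Subtype.ext
    change ((α : MForm 𝓘(ℝ, E) M ℂ (p + b))).restr (cechSet U' J) =
      (((α : MForm 𝓘(ℝ, E) M ℂ (p + b))).restr (cechSet U J)).restr (cechSet U' J)
    rw [MForm.restr_restr_of_subset (cechSet_mono hsub J)]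

variable (E M) in
/-- **Restriction of holomorphic Čech cochains to the shrunken cover**,
`C^a(𝔘, Ω^p) → C^a(𝔘', Ω^p)`. [cite: GrauertRemmert1977, Kap. VI Einleitung] -/
def cechHolShrink (a : ℕ) : CechHolForms E M U hU p a →ₗ[ℂ] CechHolForms E M U' hU' p a where
  toFun g J := holRestrict E M (isOpen_cechSet hU J) (isOpen_cechSet hU' J) (cechSet_mono hsub J) p (g J)
  map_add' g g' := by funext J; simp only [Pi.add_apply, map_add]
  map_smul' r g := by funext J; simp only [Pi.smul_apply, map_smul, RingHom.id_apply]

/-- Restriction of holomorphic cochains is a cochain map. [cite: GrauertRemmert1977, Kap. VI Einleitung] -/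
theorem cechHolShrink_cechHolδ (a : ℕ) (g : CechHolForms E M U hU p a) :
    cechHolShrink E M hU p hU' hsub (a + 1) (cechHolδ E M hU p a g) =
      cechHolδ E M hU' p a (cechHolShrink E M hU p hU' hsub a g) := by
  funext J
  apply Subtype.ext
  apply Subtype.ext
  have h := (cechDolbeaultShrink E M hU p hU' hsub).f_δ a 0 (cechHolIncl E M hU p a g)
  have h' := congrArg (fun c : CechPQForms E M U' p (a + 1) 0 ↦ (c J : MForm 𝓘(ℝ, E) M ℂ (p + 0))) h
  convert h' using 1
  · change _ = ((cechδPQ E M hU p a 0 (cechHolIncl E M hU p a g) J : MForm 𝓘(ℝ, E) M ℂ (p + 0))).restr (cechSet U' J)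
    rw [← cechHolIncl_cechHolδ]
    rfl
  · change ((cechHolIncl E M hU' p (a + 1) (cechHolδ E M hU' p a _) J : ↥(pqFormsOn E M (cechSet U' J) p 0)) :
        MForm 𝓘(ℝ, E) M ℂ (p + 0)) = _
    rw [cechHolIncl_cechHolδ]
    rfl

variable (E M) in
/-- Restriction of holomorphic cochains is a morphism of column augmentations over the shrinking
morphism. [cite: GrauertRemmert1977, Kap. VI Einleitung] -/
def cechDolbeaultColShrink :
    ADoubleComplex.RowAugmentation.Hom (cechDolbeaultCol E M hU p) (cechDolbeaultCol E M hU' p)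
      (cechDolbeaultShrink E M hU p hU' hsub).swap where
  g a := cechHolShrink E M hU p hU' hsub a
  g_dA a g := cechHolShrink_cechHolδ hU p hU' hsub a g
  ε_g _ _ := rfl

/-- **Naturality of the Čech–Dolbeault isomorphism under shrinking of the cover**: for finite
`∂̄`-acyclic covers `𝔘' ≤ 𝔘` (`U'_i ⊆ U_i`) of a Hausdorff σ-compact complex manifold,
`cechDolbeaultEquiv 𝔘' = H^q(restriction) ∘ cechDolbeaultEquiv 𝔘` on `H^q(A^{p,•}(M), ∂̄)`. In
particular the restriction of holomorphic cochains induces an isomorphism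
`H^q(𝔘, Ω^p) ≅ H^q(𝔘', Ω^p)`, both being `H^{p,q}_{∂̄}(M)` (Grauert–Remmert (1977), Kap. VI,
Einleitung; Griffiths–Harris (1978), p. 45). [cite: GrauertRemmert1977, Kap. VI Einleitung] -/
theorem cechDolbeaultEquiv_natural [SigmaCompactSpace M] [Fintype ι] (hcov : ⋃ i, U i = univ)
    (hcov' : ⋃ i, U' i = univ)
    (hacyc : ∀ (a : ℕ) (J : Fin (a + 1) → ι), IsDolbeaultAcyclic E M (isOpen_cechSet hU J) p)
    (hacyc' : ∀ (a : ℕ) (J : Fin (a + 1) → ι), IsDolbeaultAcyclic E M (isOpen_cechSet hU' J) p)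
    (q : ℕ) (c : NatCochain.Cohomology (R := ℂ) (fun b ↦ localDbar E M (isOpen_univ : IsOpen (univ : Set M)) p b) q) :
    cechDolbeaultEquiv E M hU' p hcov' hacyc' q c =
      NatCochain.Cohomology.map (R := ℂ) (A := CechHolForms E M U hU p) (A' := CechHolForms E M U' hU' p)
        (cechHolShrink E M hU p hU' hsub) (cechHolShrink_cechHolδ hU p hU' hsub) q
        (cechDolbeaultEquiv E M hU p hcov hacyc q c) := by
  have h := ADoubleComplex.rowColEquiv_natural (cechDolbeaultShrink E M hU p hU' hsub)
    (cechDolbeaultRowShrink E M hU p hU' hsub) (cechDolbeaultColShrink E M hU p hU' hsub)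
    (cechDolbeault_rowExact hU p _ (SmoothPartitionOfUnity.exists_isSubordinate 𝓘(ℝ, E) isClosed_univ U hU
      hcov.symm.subset).choose_spec)
    (cechDolbeaultRow_exact hU p _ (SmoothPartitionOfUnity.exists_isSubordinate 𝓘(ℝ, E) isClosed_univ U hU
      hcov.symm.subset).choose_spec fun y ↦ mem_iUnion.1 (hcov.symm.subset (mem_univ y)))
    (cechDolbeault_colExact hU p hacyc) (cechDolbeaultCol_exact hU p)
    (cechDolbeault_rowExact hU' p _ (SmoothPartitionOfUnity.exists_isSubordinate 𝓘(ℝ, E) isClosed_univ U' hU'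
      hcov'.symm.subset).choose_spec)
    (cechDolbeaultRow_exact hU' p _ (SmoothPartitionOfUnity.exists_isSubordinate 𝓘(ℝ, E) isClosed_univ U' hU'
      hcov'.symm.subset).choose_spec fun y ↦ mem_iUnion.1 (hcov'.symm.subset (mem_univ y)))
    (cechDolbeault_colExact hU' p hacyc') (cechDolbeaultCol_exact hU' p) q c
  have hid : (cechDolbeaultRowShrink E M hU p hU' hsub).cohMap q c = c :=
    NatCochain.Cohomology.map_id_apply _ q c
  rw [hid] at h
  exact h

end Shrink

/-! ### The global complex computes the tree's Dolbeault cohomology -/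

/-- **The Dolbeault complex `(A^{p,•}(M), ∂̄)` (global forms in the sense of `pqFormsOn univ`)
computes the tree's Dolbeault cohomology** `dolbeaultCohomology E M p q`: same cocycles
(`mem_dolbeaultClosedForms_iff`), same coboundaries (`mem_dolbeaultExactForms_succ_iff`).
[cite: VoisinHodgeI2002, §2.3.3] -/
theorem nonempty_cohomology_equiv_dolbeaultCohomology (q : ℕ) :
    Nonempty (NatCochain.Cohomology (R := ℂ) (fun b ↦ localDbar E M (isOpen_univ : IsOpen (univ : Set M)) p b) q ≃ₗ[ℂ]
      dolbeaultCohomology E M p q) := by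
  refine nonempty_subquotient_equiv (pqFormsOn E M (univ : Set M) p q).subtype _ _ _ _ ?_ ?_
  · ext α
    simp only [Submodule.mem_map, Submodule.subtype_apply]
    rw [mem_dolbeaultClosedForms_iff isSmoothForm_typeComponent_holds dolbeaultBar_smul_holds]
    constructor
    · rintro ⟨β, hβ, rfl⟩
      have hβ' := (mem_pqForms_iff _).1 (mem_pqFormsOn_univ_iff.1 β.2)
      refine ⟨hβ'.1, hβ'.2, ?_⟩
      have h := (NatCochain.mem_cocycles_iff _).1 hβ
      rw [Subtype.ext_iff, coe_localDbar_univ] at h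
      exact h
    · rintro ⟨hs, ht, hd⟩
      refine ⟨⟨α, mem_pqFormsOn_univ_iff.2 ((mem_pqForms_iff _).2 ⟨hs, ht⟩)⟩,
        (NatCochain.mem_cocycles_iff _).2 (Subtype.ext ?_), rfl⟩
      rw [coe_localDbar_univ]
      exact hd
  · intro β _
    rw [Submodule.subtype_apply]
    cases q with
    | zero =>
      rw [NatCochain.coboundaries_zero, Submodule.mem_bot, dolbeaultExactForms_zero, Submodule.mem_bot,
        ZeroMemClass.coe_eq_zero]
    | succ q =>
      rw [NatCochain.mem_coboundaries_succ_iff, mem_dolbeaultExactForms_succ_iff]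
      constructor
      · rintro ⟨γ, hγ, hγβ⟩
        refine ⟨⟨γ, mem_pqFormsOn_univ_iff.2 hγ⟩, Subtype.ext ?_⟩
        rw [coe_localDbar_univ]
        exact hγβ
      · rintro ⟨γ, rfl⟩
        exact ⟨γ, mem_pqFormsOn_univ_iff.1 γ.2, (coe_localDbar_univ γ).symm⟩

end Cech

end Literature.Geometry.Kaehler

end
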